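import Literature.Geometry.Lorentzian.CauchyDevelopmentIsometryClasses
import Literature.Geometry.Lorentzian.OpensCausality
import HarnessLib

/-!
# Lifting endless timelike curves along an injective local isometry
# (Sbierski 2016, §3.3, proof of Thm. 5: "`γ|_J` can be considered as an inextendible timelike
# curve in `M`")

In the proof that the gluing `M̃ = M ∪_U M'` of two globally hyperbolic developments along a
common development is again globally hyperbolic (J. Sbierski, Ann. Henri Poincaré 17 (2016) =
arXiv:1309.7591v3, §3.3, proof of Thm. 5), an inextendible timelike curve `γ` of `M̃` is cut into
its maximal pieces inside the open sets `π j(M)`, `π j'(M')`, `π j(U)`, and each piece is regarded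
as an inextendible timelike curve of `M`, `M'`, `U`: *"If we denote with `J ∋ t₀` the maximal
connected subinterval of `I` such that `γ(J) ⊆ (π ∘ j)(M)`, then `γ|_J` can be considered as an
inextendible timelike curve in `M`"*. This file proves that step for a general injective local
isometry:

* `LorentzianMetric.exists_lift_isEndlessTimelikeCurve` — for `Φ : N → P` an injective `C^∞`
  local diffeomorphism between time-oriented Lorentzian manifolds which is a time-orientation
  preserving isometric immersion, the piece of an endless timelike curve `γ` of `P` through a
  point of `Φ(N)` (the connected component `J` of that parameter in `γ⁻¹(Φ(N))`) lifts along `Φ`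
  to an endless timelike curve of `N` on `J`.

Proof: locally the lift is `Φ⁻¹ ∘ γ` for a smooth local inverse (injectivity makes it single
valued), hence differentiable with `dΦ(δ') = γ'`, timelike (isometry) and future-directed
(converse timecone lemma, `PreservesTimeOrientation.isFutureDirected_of_mfderiv`); an endpoint of
the lift in `N` would be mapped to an endpoint of the piece of `γ` inside the open set `Φ(N)`,
excluded by `not_hasFutureEndpoint_connectedComponentIn` (`OpensCausality`). The case of the
inclusion of an open sub-spacetime is `OpensCausality`/`CauchyHypersurfaceOpensIntersection`.
Everything is proved; no definitions and no named facts are introduced (D-0026).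

## References

* J. Sbierski, Ann. Henri Poincaré 17 (2016) 301–329 = arXiv:1309.7591v3, §3.3, proof of
  Thm. 5 (global hyperbolicity step, p. 18 of the arXiv version).
* B. O'Neill, *Semi-Riemannian geometry with applications to relativity*, 1983, Ch. 3, pp. 90–91
  (local isometries), Ch. 5, p. 145 (timecones), Ch. 14, Def. 14.28.
-/

noncomputable section

open Bundle Set Function Filter TopologicalSpace Topology Manifold
open scoped Manifold ContDiff Topology

namespace Literature.Geometry.Lorentzian

/-! ### Lifting endless timelike curves along an injective local isometry -/

section Lift

variable {EN : Type*} [NormedAddCommGroup EN] [NormedSpace ℝ EN] {HN : Type*} [TopologicalSpace HN]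
  {IN : ModelWithCorners ℝ EN HN} {N : Type*} [TopologicalSpace N] [ChartedSpace HN N]
  [IsManifold IN ∞ N]
  {EP : Type*} [NormedAddCommGroup EP] [NormedSpace ℝ EP] {HP : Type*} [TopologicalSpace HP]
  {IP : ModelWithCorners ℝ EP HP} {P : Type*} [TopologicalSpace P] [ChartedSpace HP P]
  [IsManifold IP ∞ P]

/-- **Lifting endless timelike curves along an injective local isometry.** Let `Φ : N → P` be
an injective `C^∞` local diffeomorphism between time-oriented Lorentzian manifolds which is an
isometric immersion preserving the time orientations, `γ` an endless timelike curve of `P` on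
the parameter interval `s`, and `γ t₀ ∈ Φ(N)`. Let `J` be the connected component of `t₀` in
`{t ∈ s | γ t ∈ Φ(N)}`. Then `γ|_J` lifts along `Φ` to an endless timelike curve `δ` of `N` on
`J`: locally `δ = Φ⁻¹ ∘ γ` for a smooth local inverse (injectivity makes the lift single valued),
so `δ` is differentiable with `dΦ(δ') = γ'`, timelike (isometry) and future-directed (converse
timecone lemma `PreservesTimeOrientation.isFutureDirected_of_mfderiv`); an endpoint `q` of `δ|_J`
would give the endpoint `Φ q ∈ Φ(N)` of `γ|_J`, impossible for the maximal piece inside the open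
set `Φ(N)` (`not_hasFutureEndpoint_connectedComponentIn`). This is *"`γ|_J` can be considered as
an inextendible timelike curve in `M`"* (Sbierski 2016, §3.3, proof of Thm. 5).
[cite: Sbierski2016AHP, §3.3, proof of Thm. 5 (global hyperbolicity step)] -/
theorem LorentzianMetric.exists_lift_isEndlessTimelikeCurve [T2Space P]
    {gN : LorentzianMetric IN ∞ N} (τN : TimeOrientation gN)
    {gP : LorentzianMetric IP ∞ P} (τP : TimeOrientation gP) {Φ : N → P}
    (hΦ : gN.IsIsometricImmersion gP.toPseudoRiemannianMetric Φ)
    (hτ : τN.PreservesTimeOrientation Φ τP) (hinj : Injective Φ)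
    (hloc : IsLocalDiffeomorph IN IP ∞ Φ)
    {γ : ℝ → P} {s : Set ℝ} (hγ : gP.IsEndlessTimelikeCurve τP γ s) {t₀ : ℝ} (ht₀ : t₀ ∈ s)
    (hγt₀ : γ t₀ ∈ range Φ) :
    ∃ δ : ℝ → N, (∀ t ∈ connectedComponentIn (s ∩ γ ⁻¹' range Φ) t₀, Φ (δ t) = γ t) ∧
      gN.IsEndlessTimelikeCurve τN δ (connectedComponentIn (s ∩ γ ⁻¹' range Φ) t₀) := by
  classical
  obtain ⟨hs, hγt, hγf, hγp⟩ := hγ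
  have hOo : IsOpen (range Φ) := hloc.isOpen_range
  set J := connectedComponentIn (s ∩ γ ⁻¹' range Φ) t₀ with hJ
  have hJsub : J ⊆ s ∩ γ ⁻¹' range Φ := connectedComponentIn_subset _ _
  have ht₀J : t₀ ∈ J := mem_connectedComponentIn ⟨ht₀, hγt₀⟩
  have hJord : J.OrdConnected :=
    isPreconnected_iff_ordConnected.1 isPreconnected_connectedComponentIn
  have hcont : ∀ t ∈ s, ContinuousAt γ t := fun t ht ↦ (hγt t ht).1.continuousAt
  have hΦd : MDifferentiable IN IP Φ := hΦ.1.mdifferentiable (by simp)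
  -- the lift
  obtain ⟨n₀, hn₀⟩ := hγt₀
  set δ : ℝ → N := fun t ↦ if h : γ t ∈ range Φ then h.choose else n₀ with hδdef
  have hδ : ∀ t, γ t ∈ range Φ → Φ (δ t) = γ t := fun t h ↦ by
    simp only [hδdef, dif_pos h]
    exact h.choose_spec
  -- locally `δ = e⁻¹ ∘ γ` for a local inverse `e⁻¹` of `Φ`
  have hlocal : ∀ t ∈ J, ∃ e : PartialDiffeomorph IN IP N P ∞,
      γ t ∈ e.target ∧ δ =ᶠ[𝓝 t] (e.symm ∘ γ) := by
    intro t ht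
    obtain ⟨e, hsrc, heq⟩ := hloc (δ t)
    have hΦδ : Φ (δ t) = γ t := hδ t (hJsub ht).2
    have htgt : γ t ∈ e.target := by
      rw [← hΦδ, heq hsrc]
      exact e.map_source hsrc
    refine ⟨e, htgt, ?_⟩
    have hnhds : ∀ᶠ t' in 𝓝 t, γ t' ∈ e.target :=
      (hcont t (hJsub ht).1).preimage_mem_nhds (e.open_target.mem_nhds htgt)
    filter_upwards [hnhds] with t' ht'
    have hw : e.symm (γ t') ∈ e.source := e.map_target ht'
    have hΦw : Φ (e.symm (γ t')) = γ t' := by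
      rw [heq hw]
      exact e.right_inv ht'
    exact hinj ((hδ t' ⟨_, hΦw⟩).trans hΦw.symm)
  -- differentiability of the lift and `dΦ(δ') = γ'`
  have hvel : ∀ t ∈ J, MDifferentiableAt 𝓘(ℝ, ℝ) IN δ t ∧
      mfderiv IN IP Φ (δ t) (velocity IN δ t) = velocity IP γ t := by
    intro t ht
    obtain ⟨e, htgt, hev⟩ := hlocal t ht
    have hγd : MDifferentiableAt 𝓘(ℝ, ℝ) IP γ t := (hγt t (hJsub ht).1).1
    have hes : ContMDiffAt IP IN ∞ e.symm (γ t) :=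
      e.contMDiffOn_invFun.contMDiffAt (e.open_target.mem_nhds htgt)
    have hd : MDifferentiableAt 𝓘(ℝ, ℝ) IN (e.symm ∘ γ) t :=
      (hes.mdifferentiableAt (by simp)).comp t hγd
    have hδd : MDifferentiableAt 𝓘(ℝ, ℝ) IN δ t := hev.mdifferentiableAt_iff.2 hd
    refine ⟨hδd, ?_⟩
    have hev2 : γ =ᶠ[𝓝 t] (Φ ∘ δ) := by
      have hnhds : ∀ᶠ t' in 𝓝 t, γ t' ∈ range Φ :=
        (hcont t (hJsub ht).1).preimage_mem_nhds (hOo.mem_nhds (hJsub ht).2)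
      filter_upwards [hnhds] with t' ht'
      exact (hδ t' ht').symm
    have h1 : mfderiv 𝓘(ℝ, ℝ) IP γ t = (mfderiv IN IP Φ (δ t)).comp (mfderiv 𝓘(ℝ, ℝ) IN δ t) := by
      rw [hev2.mfderiv_eq, mfderiv_comp t (hΦd _) hδd]
    change mfderiv IN IP Φ (δ t) (mfderiv 𝓘(ℝ, ℝ) IN δ t (1 : ℝ)) = mfderiv 𝓘(ℝ, ℝ) IP γ t (1 : ℝ)
    rw [h1]
    rfl
  -- the isometry identity
  have key : ∀ (x : N) (u w : TangentSpace IN x),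
      gP.val (Φ x) (mfderiv IN IP Φ x u) (mfderiv IN IP Φ x w) = gN.val x u w := fun x u w ↦ by
    have h := congrArg (fun b ↦ b u w) (hΦ.2 x)
    simpa only [pullbackBilin_apply] using h
  -- `δ` is a future timelike curve of `N` on `J`
  have hδt : gN.IsFutureTimelikeCurveOn τN δ J := fun t ht ↦ by
    obtain ⟨hδd, hv⟩ := hvel t ht
    obtain ⟨-, h1, h2⟩ := hγt t (hJsub ht).1
    have hpt : Φ (δ t) = γ t := hδ t (hJsub ht).2
    refine ⟨hδd, ?_, ?_⟩
    · change gN.val (δ t) (velocity IN δ t) (velocity IN δ t) < 0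
      rw [← key, hv]
      have hgen : ∀ p, p = γ t → gP.val p (velocity IP γ t) (velocity IP γ t) < 0 := by
        rintro p rfl
        exact h1
      exact hgen _ hpt
    · have hfd : τP.IsFutureDirected (x := Φ (δ t)) (mfderiv IN IP Φ (δ t) (velocity IN δ t)) := by
        rw [hv]
        have hgen : ∀ p, p = γ t → τP.IsFutureDirected (x := p) (velocity IP γ t) := by
          rintro p rfl
          exact h2
        exact hgen _ hpt
      exact hτ.isFutureDirected_of_mfderiv hΦ.2 hfd
  -- `δ` is endless on `J`
  have hδf : IsFutureEndless δ J := by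
    refine ⟨⟨t₀, ht₀J⟩, fun q hq ↦ ?_⟩
    have h1 : HasFutureEndpoint (Φ ∘ δ) J (Φ q) := (hΦ.1.continuous.tendsto q).comp hq
    have h2 : HasFutureEndpoint γ J (Φ q) := h1.congr fun t ↦ hδ t (hJsub t.2).2
    exact not_hasFutureEndpoint_connectedComponentIn hs hcont hγf hOo ht₀ ⟨n₀, hn₀⟩ ⟨q, rfl⟩ h2
  have hδp : IsPastEndless δ J := by
    refine ⟨⟨t₀, ht₀J⟩, fun q hq ↦ ?_⟩
    have h1 : HasPastEndpoint (Φ ∘ δ) J (Φ q) := (hΦ.1.continuous.tendsto q).comp hq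
    have h2 : HasPastEndpoint γ J (Φ q) := h1.congr fun t ↦ hδ t (hJsub t.2).2
    exact not_hasPastEndpoint_connectedComponentIn hs hcont hγp hOo ht₀ ⟨n₀, hn₀⟩ ⟨q, rfl⟩ h2
  exact ⟨δ, fun t ht ↦ hδ t (hJsub ht).2, hJord, hδt, hδf, hδp⟩

end Lift

end Literature.Geometry.Lorentzian

end
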